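import Literature.AlgebraicGeometry.ComplexMultiplication.ShimuraIsogeny
import Literature.AlgebraicGeometry.Milne1999.HodgeCMImpliesTateFiniteFields
import Literature.AlgebraicGeometry.Motives.VarietiesDimensionProofs
import Literature.AlgebraicGeometry.HodgeTheory.AbelianVarietyEndomorphismsHOne
import Literature.NumberTheory.DiophantineGeometry.AVIsogenyTateFreeHomProofs
import Literature.AlgebraicGeometry.Motives.AbelianVarietyEndAlgebraSemisimpleProofs
import Mathlib.RingTheory.Localization.Integer
import Literature.AlgebraicGeometry.Motives.AbelianVarietyProductIsogeny
import Literature.AlgebraicGeometry.Motives.AbelianVarietyProductDimProofs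
import Literature.AlgebraicGeometry.Motives.BaseChangeAlongInverse
import Literature.NumberTheory.DiophantineGeometry.AVIsogenyTateHoldsProofs
import Literature.AlgebraicGeometry.Milne1999.CMHodgeHypothesisFromCMTypedProducts
import Literature.AlgebraicGeometry.HodgeTheory.HodgeFiltrationModelsReductionProofs
import HarnessLib

/-!
# (H) ⟹ (I): Milne's hypothesis implies the Hodge conjecture for the realised CM codes

Milne 1999, Theorem 7.1, takes as hypothesis (H) «the Hodge conjecture holds for all Abelian
varieties of CM-type over `C`» (§7, p. 72, Theorem 7.1, verbatim), with «of CM-type» as on p. 54: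
«A simple Abelian variety `A` over `C` is said to be of CM-type if `End⁰(A)` is a field (necessarily
CM) of degree `2 dim A` over `Q`, and an arbitrary Abelian variety over `C` is said to be of CM-type
if all its simple isogeny factors are of CM-type» — rendered in the tree (as in Deligne, LNM 900, §5 p. 63 and Prop. 5.1) by the
étale condition `Milne1999.IsOfCMType A`: `End⁰(A)` contains a commutative reduced `ℚ`-subalgebra of
`ℚ`-dimension `2 dim A`.  The published-programme side of the cell reads (H) on the realised CM codes
of the Picard–CM index type, `Milne1999.CodesHC` (=: (I)).

The tree already has (I) ⟹ (H) over explicit binders (`forall_cmHodgeHypothesisAt_of_codesHC`,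
`…_of_hcor`).  This file proves the converse **(H) ⟹ (I) in the kernel, with no binder at all**
(`codesHC_of_forall_cmHodgeHypothesisAt`): every CM-flagged code interprets to (the underlying
variety of) an abelian variety which is of CM-type in the étale sense.  The two ingredients, both
proved here:

* `ComplexMultiplication.IsCMTypeRealisation.isOfCMType` — a realisation `(A, ι : 𝓞_K → End A, θ)`
  of a CM type `(K; Φ)` of a CM field (Shimura 1998 §5.2, «`(A, ι)` of type `(F; {φ_i})`») is of
  CM-type: `ℚ·ι(𝓞_K) ⊂ End⁰(A)` is a commutative reduced subalgebra of dimension `[K:ℚ] = 2 dim A`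
  (`ι` is injective because `θ = ι^*` on `H¹ ≠ 0` is, `End(A) → End⁰(A)` is injective, and
  `ℚ ⊗ 𝓞_K = K`);
* `Milne1999.IsOfCMType.prod` — products of abelian varieties of CM-type are of CM-type (Deligne,
  LNM 900, §5 p. 63: «`A` is of CM-type if and only if each `A_α` is of CM-type»): the block-diagonal
  subalgebra `S × 0 + 0 × T ⊂ End⁰(A × B)` built from the corner embeddings
  `End⁰(A), End⁰(B) → End⁰(A × B)` (`f ↦ f × 0`, `g ↦ 0 × g`, base-changed to `ℚ`), which is
  commutative, reduced, and of dimension `dim S + dim T` (the corner retractions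
  `h ↦ ι₁ h pr₁`, `h ↦ ι₂ h pr₂` show `(s, t) ↦ s × 0 + 0 × t` is injective).

With the tree's `forall_cmHodgeHypothesisAt_of_codesHC` and the kernel theorem
`HodgeTheory.isogenyInvariance_hodgeConjectureFor` (van Geemen 1994, Lemma 3.7) this gives the
equivalence (H) ⟺ (I) over the single residual binder `hDom` (stated where both are imported,
`Milne1999/TateFromCodesHC.lean`).

## References
* [Milne1999] J. S. Milne, *Lefschetz motives and the Tate conjecture*, Compositio Math. 117 (1999),
  §2 p. 54 (CM-type), §7 p. 72 (hypothesis (H)).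
* [Deligne1982HodgeCycles] P. Deligne, *Hodge cycles on abelian varieties*, LNM 900 (1982), §5 p. 63
  and Prop. 5.1.
* [Shimura1998] G. Shimura, *Abelian varieties with complex multiplication and modular functions*,
  Princeton (1998), §5.2.
* [MumfordAV1970] D. Mumford, *Abelian varieties* (1970), §19 Thm. 3 (`End(A)` is a finitely
  generated free `ℤ`-module; `End(A) → End⁰(A)` injective).
* [vanGeemen1994HodgeAV] B. van Geemen, *An introduction to the Hodge conjecture for abelian
  varieties*, LNM 1594 (1994), Lemma 3.7.
-/

noncomputable section

open CategoryTheory NumberField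

namespace Literature.AlgebraicGeometry.Motives

namespace AbelianVariety

open CategoryTheory.Limits

section ProdMap

variable {k : Type} [Field k] {A B : AbelianVariety k}

/-! ### `prodMap` is functorial and additive -/

/-- `prodMap (𝟙 A) (𝟙 B) = 𝟙 (A × B)`. [folklore] -/
theorem prodMap_id : prodMap (𝟙 A) (𝟙 B) = 𝟙 (A.prod B) :=
  prod_hom_ext (by rw [prodMap_fst, Category.comp_id, Category.id_comp])
    (by rw [prodMap_snd, Category.comp_id, Category.id_comp])

/-- `prodMap f g ≫ prodMap f' g' = prodMap (f ≫ f') (g ≫ g')`. [folklore] -/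
theorem prodMap_comp_prodMap {A' B' A'' B'' : AbelianVariety k} (f : A ⟶ A') (g : B ⟶ B')
    (f' : A' ⟶ A'') (g' : B' ⟶ B'') :
    prodMap f g ≫ prodMap f' g' = prodMap (f ≫ f') (g ≫ g') :=
  prod_hom_ext
    (by rw [Category.assoc, prodMap_fst, ← Category.assoc, prodMap_fst, Category.assoc, prodMap_fst])
    (by rw [Category.assoc, prodMap_snd, ← Category.assoc, prodMap_snd, Category.assoc, prodMap_snd])

/-- `prodMap (f + f') (g + g') = prodMap f g + prodMap f' g'` (the category of abelian varieties is
preadditive). [folklore] -/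
theorem prodMap_add {A' B' : AbelianVariety k} (f f' : A ⟶ A') (g g' : B ⟶ B') :
    prodMap (f + f') (g + g') = prodMap f g + prodMap f' g' :=
  prod_hom_ext
    (by rw [prodMap_fst, Preadditive.add_comp, prodMap_fst, prodMap_fst, Preadditive.comp_add])
    (by rw [prodMap_snd, Preadditive.add_comp, prodMap_snd, prodMap_snd, Preadditive.comp_add])

/-- `prodMap 0 0 = 0`. [folklore] -/
theorem prodMap_zero {A' B' : AbelianVariety k} :
    prodMap (0 : A ⟶ A') (0 : B ⟶ B') = 0 :=
  prod_hom_ext (by rw [prodMap_fst, comp_zero, zero_comp]) (by rw [prodMap_snd, comp_zero, zero_comp])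

/-- The first component of `prodMap f g` is recovered as `ι₁ ≫ prodMap f g ≫ pr₁ = f`. [folklore] -/
theorem inl_prodMap_fst {A' B' : AbelianVariety k} (f : A ⟶ A') (g : B ⟶ B') :
    prodLift (𝟙 A) (0 : A ⟶ B) ≫ prodMap f g ≫ fst A' B' = f := by
  rw [prodMap_fst, ← Category.assoc, prodLift_fst, Category.id_comp]

/-- The second component of `prodMap f g` is recovered as `ι₂ ≫ prodMap f g ≫ pr₂ = g`. [folklore] -/
theorem inr_prodMap_snd {A' B' : AbelianVariety k} (f : A ⟶ A') (g : B ⟶ B') :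
    prodLift (0 : B ⟶ A) (𝟙 B) ≫ prodMap f g ≫ snd A' B' = g := by
  rw [prodMap_snd, ← Category.assoc, prodLift_snd, Category.id_comp]

/-! ### The same in the endomorphism rings -/

/-- `prodMap` on endomorphisms, typed in the endomorphism rings `End A`, `End B`, `End (A × B)`.
[folklore] -/
def prodMapEnd (F : End A) (G : End B) : End (A.prod B) := prodMap F G

/-- `(F × G)(F' × G') = FF' × GG'` in `End (A × B)`. [folklore] -/
theorem prodMapEnd_mul (F F' : End A) (G G' : End B) :
    prodMapEnd F G * prodMapEnd F' G' = prodMapEnd (F * F') (G * G') := by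
  change prodMap F' G' ≫ prodMap F G = prodMap (F' ≫ F) (G' ≫ G)
  exact prodMap_comp_prodMap _ _ _ _

/-- `1 × 1 = 1` in `End (A × B)`. [folklore] -/
theorem prodMapEnd_one : prodMapEnd (1 : End A) (1 : End B) = 1 := by
  change prodMap (𝟙 A) (𝟙 B) = 𝟙 (A.prod B)
  exact prodMap_id

/-- `(F + F') × (G + G') = F × G + F' × G'` in `End (A × B)`. [folklore] -/
theorem prodMapEnd_add (F F' : End A) (G G' : End B) :
    prodMapEnd (F + F') (G + G') = prodMapEnd F G + prodMapEnd F' G' := by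
  change prodMap (F + F') (G + G') = prodMap F G + prodMap F' G'
  exact prodMap_add _ _ _ _

/-- `0 × 0 = 0` in `End (A × B)`. [folklore] -/
theorem prodMapEnd_zero : prodMapEnd (0 : End A) (0 : End B) = 0 := by
  change prodMap (0 : A ⟶ A) (0 : B ⟶ B) = 0
  exact prodMap_zero

/-- `(F × 0)(F' × 0) = FF' × 0`. [folklore] -/
theorem prodMapEnd_zero_mul_zero (F F' : End A) :
    prodMapEnd F (0 : End B) * prodMapEnd F' 0 = prodMapEnd (F * F') 0 := by
  rw [prodMapEnd_mul, mul_zero]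

/-- `(0 × G)(0 × G') = 0 × GG'`. [folklore] -/
theorem prodMapEnd_mul_zero_zero (G G' : End B) :
    prodMapEnd (0 : End A) G * prodMapEnd 0 G' = prodMapEnd 0 (G * G') := by
  rw [prodMapEnd_mul, mul_zero]

/-- `(F × 0)(0 × G) = 0`. [folklore] -/
theorem prodMapEnd_left_mul_right (F : End A) (G : End B) :
    prodMapEnd F (0 : End B) * prodMapEnd (0 : End A) G = 0 := by
  rw [prodMapEnd_mul, mul_zero, zero_mul, prodMapEnd_zero]

/-- `(0 × G)(F × 0) = 0`. [folklore] -/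
theorem prodMapEnd_right_mul_left (F : End A) (G : End B) :
    prodMapEnd (0 : End A) G * prodMapEnd F (0 : End B) = 0 := by
  rw [prodMapEnd_mul, mul_zero, zero_mul, prodMapEnd_zero]

/-- `1 × 0 + 0 × 1 = 1`. [folklore] -/
theorem prodMapEnd_one_zero_add_zero_one :
    prodMapEnd (1 : End A) (0 : End B) + prodMapEnd (0 : End A) (1 : End B) = 1 := by
  rw [← prodMapEnd_add, add_zero, zero_add, prodMapEnd_one]

/-- `ι₁ (F × G) pr₁ = F`, in `End A`. [folklore] -/
def cornerLeftEnd (H : End (A.prod B)) : End A := prodLift (𝟙 A) (0 : A ⟶ B) ≫ H ≫ fst A B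

/-- `ι₂ (F × G) pr₂ = G`, in `End B`. [folklore] -/
def cornerRightEnd (H : End (A.prod B)) : End B := prodLift (0 : B ⟶ A) (𝟙 B) ≫ H ≫ snd A B

/-- `ι₁ (F × G) pr₁ = F`. [folklore] -/
theorem cornerLeftEnd_prodMapEnd (F : End A) (G : End B) : cornerLeftEnd (prodMapEnd F G) = F :=
  inl_prodMap_fst F G

/-- `ι₂ (F × G) pr₂ = G`. [folklore] -/
theorem cornerRightEnd_prodMapEnd (F : End A) (G : End B) : cornerRightEnd (prodMapEnd F G) = G :=
  inr_prodMap_snd F G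

variable (A B) in
/-- `F ↦ F × 0`, an additive map `End(A) → End(A × B)`. [folklore] -/
def prodMapLeftHom : End A →+ End (A.prod B) where
  toFun F := prodMapEnd F 0
  map_zero' := prodMapEnd_zero
  map_add' F F' := by
    change prodMapEnd (F + F') 0 = prodMapEnd F 0 + prodMapEnd F' 0
    rw [← prodMapEnd_add, add_zero]

variable (A B) in
/-- `G ↦ 0 × G`, an additive map `End(B) → End(A × B)`. [folklore] -/
def prodMapRightHom : End B →+ End (A.prod B) where
  toFun G := prodMapEnd 0 G
  map_zero' := prodMapEnd_zero
  map_add' G G' := by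
    change prodMapEnd 0 (G + G') = prodMapEnd 0 G + prodMapEnd 0 G'
    rw [← prodMapEnd_add, add_zero]

variable (A B) in
/-- `H ↦ ι₁ H pr₁`, an additive map `End(A × B) → End(A)`. [folklore] -/
def cornerLeftHom : End (A.prod B) →+ End A where
  toFun := cornerLeftEnd
  map_zero' := by
    change prodLift (𝟙 A) 0 ≫ (0 : A.prod B ⟶ A.prod B) ≫ fst A B = 0
    rw [zero_comp, comp_zero]
  map_add' H H' := by
    change prodLift (𝟙 A) 0 ≫ (H + H') ≫ fst A B =
      prodLift (𝟙 A) 0 ≫ H ≫ fst A B + prodLift (𝟙 A) 0 ≫ H' ≫ fst A B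
    exact (congrArg (fun t => prodLift (𝟙 A) (0 : A ⟶ B) ≫ t)
      (Preadditive.add_comp _ _ _ H H' (fst A B))).trans (Preadditive.comp_add _ _ _ _ _ _)

variable (A B) in
/-- `H ↦ ι₂ H pr₂`, an additive map `End(A × B) → End(B)`. [folklore] -/
def cornerRightHom : End (A.prod B) →+ End B where
  toFun := cornerRightEnd
  map_zero' := by
    change prodLift 0 (𝟙 B) ≫ (0 : A.prod B ⟶ A.prod B) ≫ snd A B = 0
    rw [zero_comp, comp_zero]
  map_add' H H' := by
    change prodLift 0 (𝟙 B) ≫ (H + H') ≫ snd A B =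
      prodLift 0 (𝟙 B) ≫ H ≫ snd A B + prodLift 0 (𝟙 B) ≫ H' ≫ snd A B
    exact (congrArg (fun t => prodLift (0 : B ⟶ A) (𝟙 B) ≫ t)
      (Preadditive.add_comp _ _ _ H H' (snd A B))).trans (Preadditive.comp_add _ _ _ _ _ _)

end ProdMap

/-! ### The two corner embeddings `End⁰(A), End⁰(B) → End⁰(A × B)` -/

namespace endAlgebra

section Corners

variable {k : Type} [Field k] (A B : AbelianVariety k)

/-- `x ↦ x × 0 : End⁰(A) → End⁰(A × B)`, `ℚ`-linear (base change of `f ↦ f × 0`). [folklore] -/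
def prodLeft : A.endAlgebra →ₗ[ℚ] (A.prod B).endAlgebra :=
  (prodMapLeftHom A B).toIntLinearMap.baseChange ℚ

/-- `y ↦ 0 × y : End⁰(B) → End⁰(A × B)`, `ℚ`-linear. [folklore] -/
def prodRight : B.endAlgebra →ₗ[ℚ] (A.prod B).endAlgebra :=
  (prodMapRightHom A B).toIntLinearMap.baseChange ℚ

/-- `z ↦ ι₁ z pr₁ : End⁰(A × B) → End⁰(A)`, `ℚ`-linear. [folklore] -/
def cornerLeft : (A.prod B).endAlgebra →ₗ[ℚ] A.endAlgebra :=
  (cornerLeftHom A B).toIntLinearMap.baseChange ℚ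

/-- `z ↦ ι₂ z pr₂ : End⁰(A × B) → End⁰(B)`, `ℚ`-linear. [folklore] -/
def cornerRight : (A.prod B).endAlgebra →ₗ[ℚ] B.endAlgebra :=
  (cornerRightHom A B).toIntLinearMap.baseChange ℚ

variable {A B}

/-- `prodLeft (f ⊗ 1) = (f × 0) ⊗ 1`. [folklore] -/
theorem prodLeft_of (f : End A) :
    prodLeft A B (endAlgebra.of A f) = endAlgebra.of (A.prod B) (prodMapEnd f 0) :=
  LinearMap.baseChange_tmul _ (1 : ℚ) f

/-- `prodRight (g ⊗ 1) = (0 × g) ⊗ 1`. [folklore] -/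
theorem prodRight_of (g : End B) :
    prodRight A B (endAlgebra.of B g) = endAlgebra.of (A.prod B) (prodMapEnd 0 g) :=
  LinearMap.baseChange_tmul _ (1 : ℚ) g

/-- `cornerLeft (h ⊗ 1) = (ι₁ h pr₁) ⊗ 1`. [folklore] -/
theorem cornerLeft_of (h : End (A.prod B)) :
    cornerLeft A B (endAlgebra.of (A.prod B) h) = endAlgebra.of A (cornerLeftEnd h) :=
  LinearMap.baseChange_tmul _ (1 : ℚ) h

/-- `cornerRight (h ⊗ 1) = (ι₂ h pr₂) ⊗ 1`. [folklore] -/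
theorem cornerRight_of (h : End (A.prod B)) :
    cornerRight A B (endAlgebra.of (A.prod B) h) = endAlgebra.of B (cornerRightEnd h) :=
  LinearMap.baseChange_tmul _ (1 : ℚ) h

/-- A `ℚ`-linear map commutes with left multiplication by rational scalars. [folklore] -/
theorem linearMap_algebraMap_mul {E F : Type*} [Ring E] [Ring F] [Algebra ℚ E] [Algebra ℚ F]
    (φ : E →ₗ[ℚ] F) (q : ℚ) (x : E) : φ (algebraMap ℚ E q * x) = algebraMap ℚ F q * φ x := by
  rw [← Algebra.smul_def, map_smul, Algebra.smul_def]

/-- `(q·u)(q'·v) = (qq')·(uv)` for rational scalars in a `ℚ`-algebra. [folklore] -/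
theorem algebraMap_mul_mul_algebraMap_mul {E : Type*} [Ring E] [Algebra ℚ E] (q q' : ℚ) (u v : E) :
    algebraMap ℚ E q * u * (algebraMap ℚ E q' * v) = algebraMap ℚ E (q * q') * (u * v) := by
  rw [mul_assoc, ← mul_assoc u, ← Algebra.commutes q' u, mul_assoc, ← mul_assoc (algebraMap ℚ E q),
    ← map_mul]

/-- `prodLeft` on normal forms. [folklore] -/
theorem prodLeft_algebraMap_mul_of (q : ℚ) (F : End A) :
    prodLeft A B (algebraMap ℚ _ q * endAlgebra.of A F) =
      algebraMap ℚ _ q * endAlgebra.of (A.prod B) (prodMapEnd F 0) := by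
  rw [linearMap_algebraMap_mul, prodLeft_of]

/-- `prodRight` on normal forms. [folklore] -/
theorem prodRight_algebraMap_mul_of (q : ℚ) (G : End B) :
    prodRight A B (algebraMap ℚ _ q * endAlgebra.of B G) =
      algebraMap ℚ _ q * endAlgebra.of (A.prod B) (prodMapEnd 0 G) := by
  rw [linearMap_algebraMap_mul, prodRight_of]

/-- `prodLeft` is multiplicative. [folklore] -/
theorem prodLeft_mul (x x' : A.endAlgebra) :
    prodLeft A B (x * x') = prodLeft A B x * prodLeft A B x' := by
  obtain ⟨M, F, -, rfl⟩ := endAlgebra.exists_eq_algebraMap_mul_of x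
  obtain ⟨P, F', -, rfl⟩ := endAlgebra.exists_eq_algebraMap_mul_of x'
  rw [algebraMap_mul_mul_algebraMap_mul, ← map_mul, prodLeft_algebraMap_mul_of,
    prodLeft_algebraMap_mul_of, prodLeft_algebraMap_mul_of, algebraMap_mul_mul_algebraMap_mul,
    ← map_mul, prodMapEnd_zero_mul_zero]

/-- `prodRight` is multiplicative. [folklore] -/
theorem prodRight_mul (y y' : B.endAlgebra) :
    prodRight A B (y * y') = prodRight A B y * prodRight A B y' := by
  obtain ⟨M, G, -, rfl⟩ := endAlgebra.exists_eq_algebraMap_mul_of y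
  obtain ⟨P, G', -, rfl⟩ := endAlgebra.exists_eq_algebraMap_mul_of y'
  rw [algebraMap_mul_mul_algebraMap_mul, ← map_mul, prodRight_algebraMap_mul_of,
    prodRight_algebraMap_mul_of, prodRight_algebraMap_mul_of, algebraMap_mul_mul_algebraMap_mul,
    ← map_mul, prodMapEnd_mul_zero_zero]

/-- The two corners annihilate each other: `(x × 0)(0 × y) = 0`. [folklore] -/
theorem prodLeft_mul_prodRight (x : A.endAlgebra) (y : B.endAlgebra) :
    prodLeft A B x * prodRight A B y = 0 := by
  obtain ⟨M, F, -, rfl⟩ := endAlgebra.exists_eq_algebraMap_mul_of x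
  obtain ⟨P, G, -, rfl⟩ := endAlgebra.exists_eq_algebraMap_mul_of y
  rw [prodLeft_algebraMap_mul_of, prodRight_algebraMap_mul_of, algebraMap_mul_mul_algebraMap_mul,
    ← map_mul, prodMapEnd_left_mul_right, map_zero, mul_zero]

/-- `(0 × y)(x × 0) = 0`. [folklore] -/
theorem prodRight_mul_prodLeft (x : A.endAlgebra) (y : B.endAlgebra) :
    prodRight A B y * prodLeft A B x = 0 := by
  obtain ⟨M, F, -, rfl⟩ := endAlgebra.exists_eq_algebraMap_mul_of x
  obtain ⟨P, G, -, rfl⟩ := endAlgebra.exists_eq_algebraMap_mul_of y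
  rw [prodLeft_algebraMap_mul_of, prodRight_algebraMap_mul_of, algebraMap_mul_mul_algebraMap_mul,
    ← map_mul, prodMapEnd_right_mul_left, map_zero, mul_zero]

/-- `1 × 0 + 0 × 1 = 1`. [folklore] -/
theorem prodLeft_one_add_prodRight_one :
    prodLeft A B 1 + prodRight A B 1 = 1 := by
  rw [← (endAlgebra.of A).map_one, ← (endAlgebra.of B).map_one, prodLeft_of, prodRight_of,
    ← (endAlgebra.of (A.prod B)).map_add, prodMapEnd_one_zero_add_zero_one, (endAlgebra.of (A.prod B)).map_one]

/-- **Block-diagonal multiplication**: `(x × 0 + 0 × y)(x' × 0 + 0 × y') = xx' × 0 + 0 × yy'`.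
[folklore] -/
theorem prodDiag_mul (x x' : A.endAlgebra) (y y' : B.endAlgebra) :
    (prodLeft A B x + prodRight A B y) * (prodLeft A B x' + prodRight A B y') =
      prodLeft A B (x * x') + prodRight A B (y * y') := by
  rw [add_mul, mul_add, mul_add, prodLeft_mul, prodRight_mul, prodLeft_mul_prodRight,
    prodRight_mul_prodLeft, add_zero, zero_add]

/-- Powers of block-diagonal elements. [folklore] -/
theorem prodDiag_pow (x : A.endAlgebra) (y : B.endAlgebra) (n : ℕ) :
    (prodLeft A B x + prodRight A B y) ^ n = prodLeft A B (x ^ n) + prodRight A B (y ^ n) := by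
  induction n with
  | zero => rw [pow_zero, pow_zero, pow_zero, prodLeft_one_add_prodRight_one]
  | succ n ih => rw [pow_succ, ih, prodDiag_mul, ← pow_succ, ← pow_succ]

/-- `ι₁ (x × 0 + 0 × y) pr₁ = x`. [folklore] -/
theorem cornerLeft_prodDiag (x : A.endAlgebra) (y : B.endAlgebra) :
    cornerLeft A B (prodLeft A B x + prodRight A B y) = x := by
  obtain ⟨M, F, -, rfl⟩ := endAlgebra.exists_eq_algebraMap_mul_of x
  obtain ⟨P, G, -, rfl⟩ := endAlgebra.exists_eq_algebraMap_mul_of y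
  rw [map_add, prodLeft_algebraMap_mul_of, prodRight_algebraMap_mul_of, linearMap_algebraMap_mul,
    linearMap_algebraMap_mul, cornerLeft_of, cornerLeft_of, cornerLeftEnd_prodMapEnd,
    cornerLeftEnd_prodMapEnd, (endAlgebra.of A).map_zero, mul_zero, add_zero]

/-- `ι₂ (x × 0 + 0 × y) pr₂ = y`. [folklore] -/
theorem cornerRight_prodDiag (x : A.endAlgebra) (y : B.endAlgebra) :
    cornerRight A B (prodLeft A B x + prodRight A B y) = y := by
  obtain ⟨M, F, -, rfl⟩ := endAlgebra.exists_eq_algebraMap_mul_of x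
  obtain ⟨P, G, -, rfl⟩ := endAlgebra.exists_eq_algebraMap_mul_of y
  rw [map_add, prodLeft_algebraMap_mul_of, prodRight_algebraMap_mul_of, linearMap_algebraMap_mul,
    linearMap_algebraMap_mul, cornerRight_of, cornerRight_of, cornerRightEnd_prodMapEnd,
    cornerRightEnd_prodMapEnd, (endAlgebra.of B).map_zero, mul_zero, zero_add]

end Corners

/-! ### Products of commutative reduced subalgebras -/

section ProdSubalgebra

variable {k : Type} [Field k] {A B : AbelianVariety k}
  (S : Subalgebra ℚ A.endAlgebra) (T : Subalgebra ℚ B.endAlgebra)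

/-- The block-diagonal map `S × T → End⁰(A × B)`, `(x, y) ↦ x × 0 + 0 × y`. [folklore] -/
def prodDiag : (S × T) →ₗ[ℚ] (A.prod B).endAlgebra :=
  (prodLeft A B ∘ₗ S.val.toLinearMap).coprod (prodRight A B ∘ₗ T.val.toLinearMap)

/-- `prodDiag (s, t) = s × 0 + 0 × t`. [folklore] -/
theorem prodDiag_apply (p : S × T) :
    prodDiag S T p = prodLeft A B (p.1 : A.endAlgebra) + prodRight A B (p.2 : B.endAlgebra) := rfl

/-- The block-diagonal map is injective (it has the left inverse `(ι₁ · pr₁, ι₂ · pr₂)`). [folklore] -/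
theorem prodDiag_injective : Function.Injective (prodDiag S T) := by
  intro p p' h
  rw [prodDiag_apply, prodDiag_apply] at h
  have h1 := congrArg (cornerLeft A B) h
  have h2 := congrArg (cornerRight A B) h
  rw [cornerLeft_prodDiag, cornerLeft_prodDiag] at h1
  rw [cornerRight_prodDiag, cornerRight_prodDiag] at h2
  exact Prod.ext (Subtype.ext h1) (Subtype.ext h2)

/-- **The product subalgebra `S × 0 + 0 × T ⊂ End⁰(A × B)`** of subalgebras `S ⊂ End⁰(A)`,
`T ⊂ End⁰(B)`: the range of the block-diagonal map, a `ℚ`-subalgebra. [folklore] -/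
def prodSubalgebra : Subalgebra ℚ (A.prod B).endAlgebra where
  carrier := LinearMap.range (prodDiag S T)
  mul_mem' := by
    rintro _ _ ⟨p, rfl⟩ ⟨p', rfl⟩
    refine ⟨p * p', ?_⟩
    rw [prodDiag_apply, prodDiag_apply, prodDiag_apply, prodDiag_mul]
    rfl
  one_mem' := ⟨1, by rw [prodDiag_apply]; exact prodLeft_one_add_prodRight_one⟩
  add_mem' := by
    rintro _ _ ⟨p, rfl⟩ ⟨p', rfl⟩
    exact ⟨p + p', map_add _ _ _⟩
  zero_mem' := ⟨0, map_zero _⟩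
  algebraMap_mem' q := by
    refine ⟨q • 1, ?_⟩
    rw [map_smul, prodDiag_apply, Algebra.algebraMap_eq_smul_one]
    exact congrArg (q • ·) prodLeft_one_add_prodRight_one

/-- Membership in the block-diagonal subalgebra: `z = s × 0 + 0 × t` for some `s ∈ S`, `t ∈ T`. [folklore] -/
theorem mem_prodSubalgebra_iff {z : (A.prod B).endAlgebra} :
    z ∈ prodSubalgebra S T ↔ ∃ p : S × T, prodDiag S T p = z := Iff.rfl

/-- The product of commutative subalgebras is commutative. [folklore] -/
theorem prodSubalgebra_comm (hS : ∀ x ∈ S, ∀ y ∈ S, x * y = y * x)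
    (hT : ∀ x ∈ T, ∀ y ∈ T, x * y = y * x) :
    ∀ z ∈ prodSubalgebra S T, ∀ z' ∈ prodSubalgebra S T, z * z' = z' * z := by
  rintro _ ⟨p, rfl⟩ _ ⟨p', rfl⟩
  rw [prodDiag_apply, prodDiag_apply, prodDiag_mul, prodDiag_mul, hS _ p.1.2 _ p'.1.2,
    hT _ p.2.2 _ p'.2.2]

/-- The product of reduced subalgebras is reduced. [folklore] -/
theorem prodSubalgebra_isReduced [IsReduced S] [IsReduced T] : IsReduced ↥(prodSubalgebra S T) := by
  refine ⟨fun z hz ↦ ?_⟩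
  obtain ⟨n, hn⟩ := hz
  obtain ⟨p, hp⟩ := (mem_prodSubalgebra_iff S T).1 z.2
  have hzn : (z : (A.prod B).endAlgebra) ^ n = 0 := by
    rw [← Subalgebra.coe_pow, hn, Subalgebra.coe_zero]
  rw [← hp, prodDiag_apply, prodDiag_pow] at hzn
  have h1 : (p.1 : A.endAlgebra) ^ n = 0 := by
    have := congrArg (cornerLeft A B) hzn
    rwa [cornerLeft_prodDiag, map_zero] at this
  have h2 : (p.2 : B.endAlgebra) ^ n = 0 := by
    have := congrArg (cornerRight A B) hzn
    rwa [cornerRight_prodDiag, map_zero] at this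
  have hp1 : p.1 = 0 := IsNilpotent.eq_zero ⟨n, Subtype.ext (by rw [Subalgebra.coe_pow, h1]; rfl)⟩
  have hp2 : p.2 = 0 := IsNilpotent.eq_zero ⟨n, Subtype.ext (by rw [Subalgebra.coe_pow, h2]; rfl)⟩
  apply Subtype.ext
  rw [← hp, prodDiag_apply, hp1, hp2]
  change prodLeft A B 0 + prodRight A B 0 = 0
  rw [map_zero, map_zero, add_zero]

/-- Subalgebras of `End⁰(A)` are finite-dimensional over `ℚ` (`End⁰(A)` is: Mumford §19 Cor. 1–2 of
Thm. 3, the tree's `finiteDimensional_endAlgebra_holds`). [cite: MumfordAV1970, §19 Cor. 1–2 of Thm. 3] -/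
theorem moduleFinite_subalgebra (S : Subalgebra ℚ A.endAlgebra) : Module.Finite ℚ S := by
  haveI : Module.Finite ℚ A.endAlgebra := AbelianVariety.finiteDimensional_endAlgebra_holds A
  haveI : IsNoetherian ℚ A.endAlgebra :=
    @isNoetherian_of_isNoetherianRing_of_finite ℚ A.endAlgebra _ _ (Algebra.toModule) _ ‹_›
  exact Module.Finite.of_injective S.val.toLinearMap Subtype.val_injective

/-- `dim_ℚ (S × 0 + 0 × T) = dim_ℚ S + dim_ℚ T`. [folklore] -/
theorem finrank_prodSubalgebra :
    Module.finrank ℚ ↥(prodSubalgebra S T) = Module.finrank ℚ S + Module.finrank ℚ T := by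
  haveI := moduleFinite_subalgebra S
  haveI := moduleFinite_subalgebra T
  have e : Module.finrank ℚ (LinearMap.range (prodDiag S T)) = Module.finrank ℚ (S × T) :=
    (LinearEquiv.ofInjective _ (prodDiag_injective S T)).finrank_eq.symm
  rw [← Module.finrank_prod, ← e]
  rfl

end ProdSubalgebra

end endAlgebra

end AbelianVariety

end Literature.AlgebraicGeometry.Motives

namespace Literature.AlgebraicGeometry.ComplexMultiplication

open Literature.AlgebraicGeometry.Motives
open Literature.AlgebraicGeometry.HodgeTheory
open Literature.AlgebraicGeometry.Milne1999

namespace IsCMTypeRealisation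

section Algebra

variable {K : Type} [Field K] {A : AbelianVariety ℂ}

/-- The composite `ρ = (End(A) → End⁰(A)) ∘ ι : 𝓞_K → End⁰(A)` of a ring action
`ι : 𝓞_K → End(A)`. [folklore] -/
abbrev ρ (ι : 𝓞 K →+* End A) : 𝓞 K →+* A.endAlgebra := (AbelianVariety.endAlgebra.of A).comp ι

/-- **The `ℚ`-subalgebra `ℚ·ρ(𝓞_K) ⊂ End⁰(A)` generated by a ring action `ι : 𝓞_K → End(A)`.**
[folklore] -/
def cmSubalgebra (ι : 𝓞 K →+* End A) : Subalgebra ℚ A.endAlgebra :=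
  Algebra.adjoin ℚ (Set.range (ρ ι))

/-- The CM subalgebra is commutative (`𝓞_K` is). [folklore] -/
theorem cmSubalgebra_comm (ι : 𝓞 K →+* End A) :
    ∀ x ∈ cmSubalgebra ι, ∀ y ∈ cmSubalgebra ι, x * y = y * x := by
  intro x hx y hy
  have hs : ∀ a ∈ Set.range (ρ ι), ∀ b ∈ Set.range (ρ ι), Commute a b := by
    rintro _ ⟨a, rfl⟩ _ ⟨b, rfl⟩
    change ρ ι a * ρ ι b = ρ ι b * ρ ι a
    rw [← map_mul, ← map_mul, mul_comm]
  have h1 : ∀ c ∈ Set.range (ρ ι), Commute c y := fun c hc ↦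
    Algebra.commute_of_mem_adjoin_of_forall_mem_commute hy (hs c hc)
  exact (Algebra.commute_of_mem_adjoin_of_forall_mem_commute hx fun c hc ↦ (h1 c hc).symm).symm.eq

/-- As a `ℚ`-submodule the CM subalgebra is the `ℚ`-span of `ρ(𝓞_K)` (a multiplicatively closed
set containing `1`). [folklore] -/
theorem cmSubalgebra_toSubmodule (ι : 𝓞 K →+* End A) :
    Subalgebra.toSubmodule (cmSubalgebra ι) = Submodule.span ℚ (Set.range (ρ ι)) := by
  rw [cmSubalgebra, Algebra.adjoin_eq_span]
  congr 1
  have : Set.range (ρ ι) =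
      ((MonoidHom.mrange (ρ ι).toMonoidHom : Submonoid A.endAlgebra) : Set A.endAlgebra) := by
    ext x
    simp
  rw [this, Submonoid.closure_eq]

/-- Every element of the `ℚ`-span of `ρ(𝓞_K)` is `N⁻¹ · ρ(a)` for some `a ∈ 𝓞_K`, `N ≥ 1`
(clearing denominators). [folklore] -/
theorem exists_mul_eq_ρ_of_mem_span {ι : 𝓞 K →+* End A} {x : A.endAlgebra}
    (hx : x ∈ Submodule.span ℚ (Set.range (ρ ι))) :
    ∃ (N : ℕ) (a : 𝓞 K), N ≠ 0 ∧ algebraMap ℚ A.endAlgebra N * x = ρ ι a := by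
  induction hx using Submodule.span_induction with
  | mem x hx =>
    obtain ⟨a, rfl⟩ := hx
    exact ⟨1, a, one_ne_zero, by rw [Nat.cast_one, map_one, one_mul]⟩
  | zero => exact ⟨1, 0, one_ne_zero, by rw [mul_zero, map_zero]⟩
  | add x y _ _ hx hy =>
    obtain ⟨N, a, hN, ha⟩ := hx
    obtain ⟨M, b, hM, hb⟩ := hy
    refine ⟨N * M, (M : 𝓞 K) * a + (N : 𝓞 K) * b, mul_ne_zero hN hM, ?_⟩
    have h1 : algebraMap ℚ A.endAlgebra ((N : ℚ) * M) * x = algebraMap ℚ A.endAlgebra M * ρ ι a := by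
      rw [mul_comm (N : ℚ), map_mul, mul_assoc, ha]
    have h2 : algebraMap ℚ A.endAlgebra ((N : ℚ) * M) * y = algebraMap ℚ A.endAlgebra N * ρ ι b := by
      rw [map_mul, mul_assoc, hb]
    rw [mul_add, Nat.cast_mul, h1, h2, map_natCast, map_natCast, map_add, map_mul, map_mul,
      map_natCast, map_natCast]
  | smul q x _ hx =>
    obtain ⟨N, a, hN, ha⟩ := hx
    refine ⟨q.den * N, (q.num : 𝓞 K) * a, mul_ne_zero q.den_nz hN, ?_⟩
    rw [Algebra.smul_def, ← mul_assoc, ← map_mul, Nat.cast_mul,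
      show ((q.den : ℚ) * N) * q = (q.den * q) * N by ring, Rat.den_mul_eq_num, map_mul, mul_assoc, ha,
      map_intCast, map_mul, map_intCast]

/-- Every element of the CM subalgebra is `N⁻¹ · ρ(a)`, `a ∈ 𝓞_K`, `N ≥ 1`. [folklore] -/
theorem exists_mul_eq_ρ {ι : 𝓞 K →+* End A} {x : A.endAlgebra} (hx : x ∈ cmSubalgebra ι) :
    ∃ (N : ℕ) (a : 𝓞 K), N ≠ 0 ∧ algebraMap ℚ A.endAlgebra N * x = ρ ι a := by
  have hx' : x ∈ Subalgebra.toSubmodule (cmSubalgebra ι) := hx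
  rw [cmSubalgebra_toSubmodule] at hx'
  exact exists_mul_eq_ρ_of_mem_span hx'

/-- If `ρ` is injective the CM subalgebra is reduced: a nilpotent `N⁻¹ρ(a)` has `ρ(aⁿ) = 0`, so
`a = 0` (`𝓞_K` is a domain). [folklore] -/
theorem cmSubalgebra_isReduced {ι : 𝓞 K →+* End A} (hρ : Function.Injective (ρ ι)) :
    IsReduced ↥(cmSubalgebra ι) := by
  refine ⟨fun x hx ↦ ?_⟩
  obtain ⟨n, hn⟩ := hx
  obtain ⟨N, a, hN, ha⟩ := exists_mul_eq_ρ (ι := ι) x.2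
  have hxn : (x : A.endAlgebra) ^ n = 0 := by
    rw [← Subalgebra.coe_pow, hn, Subalgebra.coe_zero]
  have han : ρ ι (a ^ n) = 0 := by
    rw [map_pow, ← ha, (Algebra.commute_algebraMap_left (N : ℚ) (x : A.endAlgebra)).mul_pow, hxn,
      mul_zero]
  have ha0 : a = 0 := by
    have hnil : a ^ n = 0 := hρ (by rw [han, map_zero])
    exact IsNilpotent.eq_zero ⟨n, hnil⟩
  rw [ha0, map_zero] at ha
  have hunit : IsUnit (algebraMap ℚ A.endAlgebra (N : ℚ)) :=
    (IsUnit.mk0 (N : ℚ) (Nat.cast_ne_zero.mpr hN)).map _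
  exact Subtype.ext (hunit.mul_right_eq_zero.mp ha)

/-- If `ρ` is injective, `ρ` maps a `ℤ`-basis of `𝓞_K` to a `ℚ`-linearly independent family of
`End⁰(A)` (clear denominators and use the `ℤ`-independence of the basis). [folklore] -/
theorem linearIndependent_ρ_basis {ι : 𝓞 K →+* End A} (hρ : Function.Injective (ρ ι))
    {I : Type} [Fintype I] (b : Module.Basis I ℤ (𝓞 K)) :
    LinearIndependent ℚ (fun i ↦ ρ ι (b i)) := by
  classical
  refine Fintype.linearIndependent_iffₛ.mpr fun f g hfg i ↦ ?_
  -- clear the denominators of `f` and `g` simultaneously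
  obtain ⟨⟨D, hD⟩, hint⟩ :=
    IsLocalization.exist_integer_multiples_of_finite (nonZeroDivisors ℤ) (Sum.elim f g)
  have hn : ∀ j, ∃ n : ℤ, (n : ℚ) = (D : ℚ) * f j := fun j ↦ by
    obtain ⟨n, hn⟩ := hint (Sum.inl j)
    refine ⟨n, ?_⟩
    rw [eq_intCast] at hn
    rw [hn, Algebra.smul_def, eq_intCast, Sum.elim_inl]
  have hm : ∀ j, ∃ m : ℤ, (m : ℚ) = (D : ℚ) * g j := fun j ↦ by
    obtain ⟨m, hm⟩ := hint (Sum.inr j)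
    refine ⟨m, ?_⟩
    rw [eq_intCast] at hm
    rw [hm, Algebra.smul_def, eq_intCast, Sum.elim_inr]
  choose n hn using hn
  choose m hm using hm
  -- the integral relation `ρ (∑ n • b) = ρ (∑ m • b)`
  have key : ∀ (c : I → ℚ) (k : I → ℤ), (∀ j, (k j : ℚ) = (D : ℚ) * c j) →
      algebraMap ℚ A.endAlgebra D * ∑ j, c j • ρ ι (b j) = ρ ι (∑ j, k j • b j) := by
    intro c k hk
    calc algebraMap ℚ A.endAlgebra D * ∑ j, c j • ρ ι (b j)
        = ∑ j, algebraMap ℚ A.endAlgebra D * (c j • ρ ι (b j)) := Finset.mul_sum _ _ _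
      _ = ∑ j, ρ ι (k j • b j) := Finset.sum_congr rfl fun j _ ↦ by
          rw [Algebra.smul_def, ← mul_assoc, ← map_mul, ← hk j, map_intCast, map_zsmul, zsmul_eq_mul]
      _ = ρ ι (∑ j, k j • b j) := (map_sum (ρ ι) _ _).symm
  have hrel : ρ ι (∑ j, n j • b j) = ρ ι (∑ j, m j • b j) := by
    rw [← key f n hn, ← key g m hm, hfg]
  have hnm : n i = m i := Fintype.linearIndependent_iffₛ.mp b.linearIndependent n m (hρ hrel) i
  have hD0 : (D : ℚ) ≠ 0 := by exact_mod_cast nonZeroDivisors.ne_zero hD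
  have h2 : (D : ℚ) * f i = (D : ℚ) * g i := by rw [← hn i, ← hm i, hnm]
  exact mul_left_cancel₀ hD0 h2

/-- If `ρ` is injective, the CM subalgebra has `ℚ`-dimension `[K:ℚ]` (`K` a number field):
`ρ` of an integral basis is a `ℚ`-basis of it. [folklore] -/
theorem finrank_cmSubalgebra [NumberField K] {ι : 𝓞 K →+* End A}
    (hρ : Function.Injective (ρ ι)) :
    Module.finrank ℚ ↥(cmSubalgebra ι) = Module.finrank ℚ K := by
  let b := RingOfIntegers.basis K
  have hli := linearIndependent_ρ_basis hρ b
  have hspan : Submodule.span ℚ (Set.range fun i ↦ ρ ι (b i)) =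
      Submodule.span ℚ (Set.range (ρ ι)) := by
    apply le_antisymm
    · exact Submodule.span_mono (Set.range_comp_subset_range b (ρ ι))
    · refine Submodule.span_le.mpr ?_
      rintro _ ⟨a, rfl⟩
      rw [← b.sum_repr a, map_sum]
      refine Submodule.sum_mem _ fun i _ ↦ ?_
      rw [map_zsmul, zsmul_eq_mul, ← map_intCast (algebraMap ℚ A.endAlgebra), ← Algebra.smul_def]
      exact Submodule.smul_mem _ _ (Submodule.subset_span ⟨i, rfl⟩)
  rw [← Subalgebra.finrank_toSubmodule, cmSubalgebra_toSubmodule, ← hspan,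
    finrank_span_eq_card hli, ← Module.finrank_eq_card_basis b, RingOfIntegers.rank]

end Algebra

/-! ### Realisations of CM types are of CM type -/

variable {K : Type} [Field K] [NumberField K] {Φ : CMType K} {A : AbelianVariety ℂ}
  {ι : 𝓞 K →+* End A} {θ : K →+* Module.End ℂ (complexBetti A.X 1)}

/-- `H¹(A(ℂ); ℂ)` of a realisation of `(K; Φ)` is non-zero (`dim H¹ = [K:ℚ] ≥ 1`). [folklore] -/
theorem nontrivial_complexBetti_one (h : IsCMTypeRealisation Φ A ι θ) :
    Nontrivial (complexBetti A.X 1) := by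
  apply Module.nontrivial_of_finrank_pos (R := ℂ)
  rw [h.2.1]
  exact Module.finrank_pos

/-- The `H¹`-action `θ : K → End_ℂ H¹(A(ℂ); ℂ)` of a realisation is injective (`K` is a field and
`H¹ ≠ 0`). [folklore] -/
theorem θ_injective (h : IsCMTypeRealisation Φ A ι θ) : Function.Injective θ := by
  haveI := h.nontrivial_complexBetti_one
  exact θ.injective

/-- The action `ι : 𝓞_K → End(A)` of a realisation is injective (`ι(a)^* = θ(a)` and `θ` is
injective). [folklore] -/
theorem ι_injective (h : IsCMTypeRealisation Φ A ι θ) : Function.Injective ι := by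
  intro a b hab
  have key : θ (a : K) = θ (b : K) := by rw [← h.2.2.1 a, ← h.2.2.1 b, hab]
  exact RingOfIntegers.coe_injective (h.θ_injective key)

/-- `ρ = (End(A) → End⁰(A)) ∘ ι` is injective for a realisation (`End(A) → End⁰(A)` is injective
in characteristic zero, Mumford §19 Thm. 3). [cite: MumfordAV1970, §19 Thm. 3] -/
theorem ρ_injective (h : IsCMTypeRealisation Φ A ι θ) : Function.Injective (ρ ι) :=
  (AbelianVariety.endAlgebra.of_injective_of_charZero (A := A)).comp h.ι_injective

/-- **A realisation of a CM type is of CM type (étale form).**  If `(A, ι : 𝓞_K → End A, θ)`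
realises a CM type `(K; Φ)` of a CM field `K` on `H¹` (`IsCMTypeRealisation Φ A ι θ`: Shimura
1998 §5.2 «`(A, ι)` is of type `(F; {φ_i})`»), then `End⁰(A)` contains a commutative reduced
`ℚ`-subalgebra of dimension `2 dim A` — namely `ℚ·ι(𝓞_K) ≅ K` — i.e. `A` is of CM type in the
sense of Milne 1999 p. 54 / Milne 2021 §1.1 («`End⁰(A)` contains an étale `ℚ`-subalgebra of degree
`2 dim A`», the tree's `Milne1999.IsOfCMType`). [cite: Shimura1998, §5.2 (type `(F; {φ_i})`)]
[cite: Milne1999, §2 p. 54] -/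
theorem isOfCMType [IsCMField K] (h : IsCMTypeRealisation Φ A ι θ) : IsOfCMType A := by
  refine ⟨cmSubalgebra ι, cmSubalgebra_isReduced h.ρ_injective, cmSubalgebra_comm ι, ?_⟩
  rw [finrank_cmSubalgebra h.ρ_injective]
  have hdim : A.dim = Module.finrank ℚ K / 2 := schemeDim_eq_holds h.1
  rw [hdim, IsTotallyComplex.finrank (K := K)]
  omega

end IsCMTypeRealisation

end Literature.AlgebraicGeometry.ComplexMultiplication

/-! ### CM type (étale form) is stable under binary products -/

namespace Literature.AlgebraicGeometry.Milne1999

open Literature.AlgebraicGeometry.Motives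

/-- **A product of abelian varieties of CM type is of CM type** (étale form): if `End⁰(A) ⊇ S` and
`End⁰(B) ⊇ T` with `S`, `T` commutative reduced of dimensions `2 dim A`, `2 dim B`, then
`End⁰(A × B) ⊇ S × 0 + 0 × T`, commutative reduced of dimension `2 dim A + 2 dim B = 2 dim(A × B)`.
(Milne 1999 p. 54: «an arbitrary Abelian variety over `C` is said to be of CM-type if all its
simple isogeny factors are of CM-type» — products of CM abelian varieties are CM.)
[cite: Milne1999, §2 p. 54] -/
theorem IsOfCMType.prod {A B : AbelianVariety ℂ} (hA : IsOfCMType A) (hB : IsOfCMType B) :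
    IsOfCMType (A.prod B) := by
  obtain ⟨S, hSr, hSc, hSd⟩ := hA
  obtain ⟨T, hTr, hTc, hTd⟩ := hB
  haveI := hSr
  haveI := hTr
  refine ⟨AbelianVariety.endAlgebra.prodSubalgebra S T,
    AbelianVariety.endAlgebra.prodSubalgebra_isReduced S T,
    AbelianVariety.endAlgebra.prodSubalgebra_comm S T hSc hTc, ?_⟩
  rw [AbelianVariety.endAlgebra.finrank_prodSubalgebra, hSd, hTd, AbelianVariety.dim_prod]
  ring


open Literature.AlgebraicGeometry.HodgeTheory
open Literature.AlgebraicGeometry.ComplexMultiplication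
open Literature.NumberTheory.Automorphic

/-! ### CM-typed abelian varieties and their products are of CM type -/

/-- A CM-typed abelian variety (`IsCMTyped`: a realisation triple of a CM type of a CM field with the
maximal order acting) is of CM-type in the étale sense `IsOfCMType`.
[cite: Shimura1998, §5.2 (type `(F; {φ_i})`)] [cite: Milne1999, §2 p. 54] -/
theorem IsCMTyped.isOfCMType {B : AbelianVariety ℂ} (hB : IsCMTyped B) : IsOfCMType B := by
  obtain ⟨Φ, B, ι, θ, h⟩ := hB
  exact h.isOfCMType

/-- A finite product of CM-typed abelian varieties is of CM-type. [cite: Deligne1982HodgeCycles, §5 p. 63] -/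
theorem isOfCMType_of_isProductOf_isCMTyped {A : AbelianVariety ℂ}
    (hA : AbelianVariety.IsProductOf IsCMTyped A) : IsOfCMType A := by
  induction hA with
  | atom h => exact h.isOfCMType
  | prod _ _ ih₁ ih₂ => exact ih₁.prod ih₂

/-! ### Every CM-flagged code interprets to an abelian variety of CM type -/

/-- **The interpretation of a CM-flagged code is (the variety of) an abelian variety of CM-type.**
For a code `v` of the Picard–CM index type flagged CM (`PicardCM.Var.IsCMAbelianVariety h₃ v`: the CM
codes `(E ⊂ ℂ, Φ)` and binary products of such), the interpretation `PicardCM.Var.scheme hU h₃ v` is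
the underlying variety of an abelian variety `B` of CM-type (`IsOfCMType B`): for an atom, the chosen
realisation `(cmRealisation h₃ c).AV` of the type (`cmRealisation_isCMTypeRealisation`,
`IsCMTypeRealisation.isOfCMType`); for a product code, the product abelian variety
(`AbelianVariety.prod_X`, `PicardCM.Var.scheme_prod`, both `rfl`; `IsOfCMType.prod`).
[cite: Milne1999, §2 p. 54] [cite: Deligne1982HodgeCycles, §5 p. 63] -/
theorem exists_isOfCMType_of_isCMAbelianVariety (hU : PicardCM.BallQuotientUniformisedDatum)
    (h₃ : PicardCM.CMAbelianVarietyRealised) :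
    ∀ {v : PicardCM.Var}, PicardCM.Var.IsCMAbelianVariety h₃ v →
      ∃ B : AbelianVariety ℂ, B.X = PicardCM.Var.scheme hU h₃ v ∧ IsOfCMType B
  | .cm c, _ => ⟨(PicardCM.cmRealisation h₃ c).AV, rfl,
      (cmRealisation_isCMTypeRealisation h₃ c).isOfCMType⟩
  | .prod _ _, h => by
      obtain ⟨B₁, hB₁, hCM₁⟩ := exists_isOfCMType_of_isCMAbelianVariety hU h₃ h.1
      obtain ⟨B₂, hB₂, hCM₂⟩ := exists_isOfCMType_of_isCMAbelianVariety hU h₃ h.2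
      exact ⟨B₁.prod B₂, by rw [AbelianVariety.prod_X, hB₁, hB₂, PicardCM.Var.scheme_prod],
        hCM₁.prod hCM₂⟩
  | .pms _, h => h.elim
  | .proj _, h => h.elim

/-! ### (H) ⟹ (I), in the kernel -/

/-- **Milne's hypothesis (H) implies the Hodge conjecture for the realised CM codes (I)**, with NO
residual hypothesis: if `CMHodgeHypothesisAt A` holds for every complex abelian variety `A` (Milne
1999, §7 p. 72, Theorem 7.1: «the Hodge conjecture holds for all Abelian varieties of CM-type over
`C`»), then
`CodesHC hHD hU h₃` — the Hodge conjecture for the interpretation of every CM-flagged code — holds: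
the interpretation is the variety of an abelian variety `B` of CM-type
(`exists_isOfCMType_of_isCMAbelianVariety`), `B` is smooth projective of dimension `dim B`
(`AbelianVariety.isSmoothProjective_holds`), `dim B = dim v` (`schemeDim_eq_holds`), and (H) at `B`
is the Hodge conjecture for `B.X` (comparison of the two readings:
`codesHC_iff_forall_hodgeConjectureFor`, over the tree's theorem
`hodgePQ_independent_of_hodgeModel_holds`). [cite: Milne1999, §7 p. 72 and §2 p. 54] -/
theorem codesHC_of_forall_cmHodgeHypothesisAt {hHD : exists_isReal_hodgeModel}
    {hU : PicardCM.BallQuotientUniformisedDatum} {h₃ : PicardCM.CMAbelianVarietyRealised}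
    (hH : ∀ A : AbelianVariety ℂ, CMHodgeHypothesisAt A) : CodesHC hHD hU h₃ := by
  refine (codesHC_iff_forall_hodgeConjectureFor hHD hodgePQ_independent_of_hodgeModel_holds hU h₃).2
    fun v hv => ?_
  obtain ⟨B, hBX, hB⟩ := exists_isOfCMType_of_isCMAbelianVariety hU h₃ hv
  have hdim : B.dim = v.dim := by
    rw [AbelianVariety.dim, hBX]
    exact schemeDim_eq_holds (PicardCM.Var.isSmoothProjective hU h₃ v)
  have h := hH B AbelianVariety.isSmoothProjective_holds hB
  rw [hdim, hBX] at h
  exact h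

end Literature.AlgebraicGeometry.Milne1999

end
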